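/-
Copyright (c) 2026 the pub-hodgecm-mathlib formalisation cell (harness21).  Prover seat hodgecm-mathlib-K2E1-p02 (g0), Track B ∕ K2-LIT
(build stream 29), h413 = `stmt-HodgeConjecture-24833`, line `K2_E1_TraceFormulaBeta`, row 10 — BRIDGE between ★ p855087 `GlobalTestFunction` and the ENGINE-T1 line's
★ `UnitaryGroup.PureTensor` ∕ `PureTensor.toCc` (dealer K2E1-plan (g0) DEAL (10) collapsed to «★ by name», K2/STATUS 22:05Z ff.).  2026-09-03.
-/
import Summits.HodgeConjecture.HodgeConjecture.Theorems.K2E1GlobalTestFunctionsDefs   -- ★ p855087: `GlobalTestFunction`, `locComp`, `toAdelic`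
import Literature.NumberTheory.Rogawski1990.TestFunctions                          -- ★ `UnitaryGroup.PureTensor`, `IsUnramified`, `IsFinSmooth`, `IsArchTest`, `IsTest`
import Literature.NumberTheory.Automorphic.UnitaryGroupPureTensorContinuity         -- ★ `PureTensor.toCc`, `localPiEquiv_evalPlace_finPart`
import HarnessLib

/-!
# h413 ∕ Track B «K2-LIT», line `K2_E1_TraceFormulaBeta`, row 10 — BRIDGE `GlobalTestFunction → PureTensor`: the K2 row-10 currency IS the ENGINE-T1 line's ★ currency

Cell `pub/hodgecm-mathlib`, crux H413 = `stmt-HodgeConjecture-24833`; chair K2-lead (g0), dealer K2E1-plan (g0).  Why this file: the survey for DEAL (10) (K2/STATUS, K2E1-p02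
22:05Z ff.) found that the pure-tensor test-function currency of rows 10∕18 was ALREADY ★ in the F0 ENGINE-T1 line — ★ `UnitaryGroup.PureTensor L N H` (+ `IsTest`,
`Rogawski1990/TestFunctions`), ★ `PureTensor.toCc` (`Automorphic/UnitaryGroupPureTensorContinuity`), ★ `PureTensor₂`∕`PureTensor₂.toCc` for the endoscopic product
(`Rogawski1990/TestFunctionsPair`), ★ `GlobalTransferAwayH` — so the K2 leaf ★ p855087 `GlobalTestFunction` (levels FIXED to ★ `cmLocalIntegralLevel`, smoothness BUILT IN,
`finprod` over ★ `locComp`) is a parallel presentation of the same notion.  This file makes the two ONE: every `GlobalTestFunction` is a ★ `PureTensor` satisfying ★ `IsTest`,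
with the SAME function on `U(H)(𝔸_{L⁺})` (`toAdelic φ = (toPureTensor φ).eval`), so sockets may quantify over either currency without forking the tree.
THEOREMS + one conversion `def` (no `instance`, no `notation`, no named-fact hypothesis, no `sorry`); lane `--kind definition --supports stmt-HodgeConjecture-24833 --as helper`.

CONTENTS.
* `GlobalTestFunction.toPureTensor φ : UnitaryGroup.PureTensor L N H` — bad set `S :=` the (finite) set of places where `φ_u ≠ 𝟙_{K_u}`, levels `K v := cmLocalIntegralLevel`,
  local factors `φ.fin`, archimedean factor `φ.arch`.
* `isUnramified_toPureTensor`, `isFinSmooth_toPureTensor`, `isArchTest_toPureTensor`, **`isTest_toPureTensor`** — it is an ★ `IsTest` tensor.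
* `locComp_eq_toLocal` — the identification `locComp u g = (cmDatum L N H).toLocal u g` (★ `localPiEquiv_evalPlace_finPart`; this discharges the «TO BUILD» item of
  p855087's docstring, which was in fact ★).
* **`eval_toPureTensor`**: `(toPureTensor φ).eval g = toAdelic φ g` for every `g`; **`toCc_toPureTensor`**: ★ `PureTensor.toCc` of it IS `toAdelic φ` in `C_c`.

HONEST LABEL.  Count-neutral bridge; HC_CM is proved only modulo the 7 printed citations (2 remaining named inputs: hLiu418 = `stmt-HodgeConjecture-24832`, h413 =
`stmt-HodgeConjecture-24833`) until rung 0 closes.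
References: [Rogawski1990] §14.2 p. 233 (`f′ = ⊗ f′_v`), §4.9 p. 54; [BorelJacquet1979] §4.1.
-/

set_option autoImplicit false
-- the mandated namespace repeats `HodgeConjecture.HodgeConjecture`, as in every `Theorems/*.lean` of this sub-problem
set_option linter.dupNamespace false

noncomputable section

open NumberField IsDedekindDomain Filter Topology Set
open scoped Classical

namespace Summit.HodgeConjecture.HodgeConjecture.Cruxes.H413.K2E1GlobalTestFunctions

open Literature.NumberTheory.Automorphic Literature.NumberTheory.Automorphic.UnitaryGroup

variable {L : Type} [Field L] [NumberField L] [IsCMField L] {N : ℕ} {H : Matrix (Fin N) (Fin N) L}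

namespace GlobalTestFunction

/-- The finite EXCEPTIONAL SET of a global test function: the places `u` with `φ_u ≠ 𝟙_{U(H)(𝒪_u)}` (finite by `fin_eventually_eq_indicator`).
[cite: Rogawski1990, §14.2 p. 233] -/
def badSet (φ : GlobalTestFunction L N H) : Finset (HeightOneSpectrum (𝓞 ↥(maximalRealSubfield L))) :=
  (Filter.eventually_cofinite.1 φ.fin_eventually_eq_indicator).toFinset

/-- Off the exceptional set the local factor IS the indicator of the integral level. [cite: Rogawski1990, §14.2 p. 233] -/
theorem fin_eq_indicator_of_not_mem_badSet (φ : GlobalTestFunction L N H) {u : HeightOneSpectrum (𝓞 ↥(maximalRealSubfield L))} (hu : u ∉ φ.badSet) :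
    φ.fin u = (cmLocalIntegralLevel L N H u : Set ((UnitaryGroup.cmDatum L N H).Local u)).indicator 1 := by
  by_contra h
  exact hu ((Set.Finite.mem_toFinset _).2 h)

/-- **`GlobalTestFunction → PureTensor`**: the same data read in the ENGINE-T1 currency ★ `UnitaryGroup.PureTensor` (bad set = exceptional set, levels = the integral levels
★ `cmLocalIntegralLevel`, local and archimedean factors unchanged). [cite: Rogawski1990, §14.2 p. 233] [cite: BorelJacquet1979, §4.1] -/
def toPureTensor (φ : GlobalTestFunction L N H) : UnitaryGroup.PureTensor L N H where
  S := φ.badSet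
  K := fun v => cmLocalIntegralLevel L N H v
  loc := φ.fin
  arch := φ.arch
  loc_eq_indicator := fun _ hv => φ.fin_eq_indicator_of_not_mem_badSet hv

/-- Unfolding lemmas for `toPureTensor`. [folklore] -/
theorem toPureTensor_S (φ : GlobalTestFunction L N H) : φ.toPureTensor.S = φ.badSet := rfl

/-- The levels of `toPureTensor φ` are the integral levels. [folklore] -/
theorem toPureTensor_K (φ : GlobalTestFunction L N H) (v : HeightOneSpectrum (𝓞 ↥(maximalRealSubfield L))) :
    φ.toPureTensor.K v = cmLocalIntegralLevel L N H v := rfl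

/-- The local factors of `toPureTensor φ` are `φ.fin`. [folklore] -/
theorem toPureTensor_loc (φ : GlobalTestFunction L N H) : φ.toPureTensor.loc = φ.fin := rfl

/-- The archimedean factor of `toPureTensor φ` is `φ.arch`. [folklore] -/
theorem toPureTensor_arch (φ : GlobalTestFunction L N H) : φ.toPureTensor.arch = φ.arch := rfl

/-- `toPureTensor φ` is UNRAMIFIED in the sense of ★ `PureTensor.IsUnramified` (levels = integral levels off `S`; here everywhere). [cite: Rogawski1990, §14.2 p. 233] -/
theorem isUnramified_toPureTensor (φ : GlobalTestFunction L N H) : φ.toPureTensor.IsUnramified := fun _ _ => rfl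

/-- `toPureTensor φ` is FINITELY SMOOTH (★ `PureTensor.IsFinSmooth`: the bad local factors are locally constant with compact support — all of them are, ★ `IsLocSmooth`).
[cite: Rogawski1990, §1.6 p. 6; §14.2 p. 233] -/
theorem isFinSmooth_toPureTensor (φ : GlobalTestFunction L N H) : φ.toPureTensor.IsFinSmooth :=
  fun v _ => ⟨(φ.isLocSmooth_fin v).1, (φ.isLocSmooth_fin v).2⟩

/-- `toPureTensor φ` is an ARCHIMEDEAN TEST tensor (★ `PureTensor.IsArchTest` — the same ★ `IsArchSmooth`∕`archGroupGL` clause as the field `isArchSmooth_arch`).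
[cite: BorelJacquet1979, §4.1] -/
theorem isArchTest_toPureTensor (φ : GlobalTestFunction L N H) : φ.toPureTensor.IsArchTest := φ.isArchSmooth_arch

/-- **`toPureTensor φ` satisfies ★ `PureTensor.IsTest`.** [cite: Rogawski1990, §14.2 p. 233] -/
theorem isTest_toPureTensor (φ : GlobalTestFunction L N H) : φ.toPureTensor.IsTest :=
  ⟨φ.isUnramified_toPureTensor, φ.isFinSmooth_toPureTensor, φ.isArchTest_toPureTensor⟩

end GlobalTestFunction

/-- **`locComp u g = g_u`**: the K2 component map IS the datum's ★ `toLocal u` (★ `localPiEquiv_evalPlace_finPart`; this is the identification p855087's docstring listed as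
«TO BUILD» — it is ★). [cite: PlatonovRapinchuk1994, §5.1] [cite: BorelJacquet1979, §4.1] -/
theorem locComp_eq_toLocal (u : HeightOneSpectrum (𝓞 ↥(maximalRealSubfield L))) (g : (UnitaryGroup.cmDatum L N H).Adelic) :
    locComp L N H u g = (UnitaryGroup.cmDatum L N H).toLocal u g :=
  localPiEquiv_evalPlace_finPart (↥(maximalRealSubfield L)) L (IsCMField.complexConj L) N H u g

namespace GlobalTestFunction

/-- **`(toPureTensor φ).eval = toAdelic φ`** pointwise: on the integral box `{∀ v ∉ S, g_v ∈ K_v}` both are `φ_∞(g_∞) · ∏_{v ∈ S} φ_v(g_v)` (`toAdelic_apply_eq_prod`,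
★ `PureTensor.eval_eq_of_forall_mem`); off it ★'s `eval` is `0` by definition and `toAdelic φ g` has the vanishing factor `𝟙_{K_v}(g_v) = 0` (`finFactor_eq_zero`).
[cite: Rogawski1990, §14.2 p. 233] [cite: BorelJacquet1979, §4.1] -/
theorem eval_toPureTensor (φ : GlobalTestFunction L N H) (g : (UnitaryGroup.cmDatum L N H).Adelic) : φ.toPureTensor.eval g = toAdelic φ g := by
  by_cases hg : ∀ v ∉ φ.toPureTensor.S, (UnitaryGroup.cmDatum L N H).toLocal v g ∈ φ.toPureTensor.K v
  · rw [UnitaryGroup.PureTensor.eval_eq_of_forall_mem _ _ hg,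
      toAdelic_apply_eq_prod φ φ.badSet (fun u hu => φ.fin_eq_indicator_of_not_mem_badSet hu)
        (fun u hu => by rw [locComp_eq_toLocal]; exact hg u hu)]
    refine congrArg _ (Finset.prod_congr rfl fun u _ => ?_)
    rw [locComp_eq_toLocal]
    rfl
  · obtain ⟨v, hvS, hv⟩ : ∃ v, v ∉ φ.toPureTensor.S ∧ (UnitaryGroup.cmDatum L N H).toLocal v g ∉ φ.toPureTensor.K v := by
      by_contra h
      exact hg fun v hv => not_not.1 fun hv' => h ⟨v, hv, hv'⟩
    rw [UnitaryGroup.PureTensor.eval_eq_zero_of_not_mem _ _ hvS hv, toAdelic_apply]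
    refine (mul_eq_zero_of_right _ (finFactor_eq_zero φ v ?_)).symm
    rw [φ.fin_eq_indicator_of_not_mem_badSet hvS, locComp_eq_toLocal]
    exact Set.indicator_of_notMem hv _

/-- **★ `PureTensor.toCc (toPureTensor φ) = toAdelic φ` in `C_c(U(H)(𝔸_{L⁺}), ℂ)`** — the two row-10 realisations are the same compactly supported continuous function.
[cite: Rogawski1990, §14.2 p. 233] -/
theorem toCc_toPureTensor (φ : GlobalTestFunction L N H) :
    φ.toPureTensor.toCc (fun _ _ => rfl) φ.continuous_arch φ.hasCompactSupport_arch
        (fun v _ => (φ.isLocSmooth_fin v).1.continuous) (fun v _ => (φ.isLocSmooth_fin v).2) = toAdelic φ := by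
  ext g
  exact φ.eval_toPureTensor g

end GlobalTestFunction

end Summit.HodgeConjecture.HodgeConjecture.Cruxes.H413.K2E1GlobalTestFunctions

end
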